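import Summits.QuantumFields.YangMills.Theorems.FluctuationComparisonRegPrIntLOrganTangentSeedHClause
import Summits.QuantumFields.YangMills.Theorems.FluctuationComparisonRegPrIntLOrganTangentSeedRowMass
import HarnessLib

/-!
# THE SEED TRIPLE (form (c)): size-blind SEED CLAUSE at window `θ` + (β) for BOTH densities at base window `θ∕2` ⟹
# `∃ kT, (∀ b b′, 0 ≤ kT b b′) ∧ (∀ b, ∑ b′, kT b b′·e^{κ·tdist} ≤ wT) ∧ HClauseSq (θ∕4) (rA∕2) kT (f − f′)` — S3ᴴ's ∕ O1ᵘ-H v2's seed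
# hypothesis EXACTLY (ideator g27 №3 (c)), with the explicit θ-free, side-uniform `wT = C_H(2Bρ, rA)·ωT^{1∕4}·d·(2(1+1∕(κs∕4−κ)))^d ∕ 4`

Cell `ym3-torus` (YM ladder rung R3 = continuum `SU(2)` Yang–Mills on the three-torus — a RUNG, NOT d = 4, NOT infinite volume, NOT a mass
gap, NOT Clay).  Width seat `ym3-torus-px5` (gen 18, «width 5»); `--supports stmt-QuantumFields-20520 --as helper`, count-neutral,
definition-free, default heartbeats; no registry, binder or `Lines/` edit (registered skeleton `Lines/semiclassical_s2beta.lean` v11.4, 0∕5,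
★★OWNER RULING №36, untouched; `Lines/runpair_organ.lean` v17.2 untouched); no claim on the crux.

WHAT THIS IS.  Ideator `ym-r3-idea-1` g27's v18 draft texts (`Cruxes/FluctuationComparisonRegPrIntL/V18DraftTexts.lean` 28496b3b, №3 (c)) carry the
H-currency SEED of S3ᴴ `BackwardStabilityFinSupH` ∕ the INPUT of O1ᵘ-H v2 `OneStepTransportUH` as ONE hypothesis at the seed height `T`:
`∃ kT, (∀ b b′, 0 ≤ kT b b′) ∧ (∀ b, ∑ b′, kT b b′ * Real.exp (κ * (b.src.tdist b′.src : ℝ)) ≤ wT) ∧ HClauseSq (θBal…T ∕ 4) (rA ∕ 2) kT (fun U =>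
Real.log (ρ T U) − Real.log (ρ′ T U))`.  Its three suppliers are in the tree BY NAME: LEAD pen 9 ✓p797938 `hClauseSq_of_seed_of_analytic` (size-blind
seed clause + (β) for the discrepancy ⟹ the scaled pair clause on the shrunk window), LEAD pen 11 ✓`…SeedLetterShape` (closed form of the letters)
and ROWMASS-¼ ✓`…SeedRowMass` (their weighted row-mass).  THIS FILE threads them into EXACTLY that triple, generically (any `Params P`, level `j`,
abstract `f, f′` for `log ρ_T, log ρ′_T`), with the conventions of №3 (a)–(c): pen 9 at `(θ := θ∕2, cH := 1∕2, r := rA, B := Bρ + Bρ)` — corners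
`θ∕4`, cap `rA·(θ∕2)∕4 = (rA∕2)·(θ∕4)`, letters `K·(θ∕2)²` in sizes `∕(θ∕2)` = `K·(θ∕2)²∕4` in sizes `∕(θ∕4)` (ONE conversion, here); `hroom`
`1∕2 + 6·rA ≤ 1 ⇔ rA ≤ 1∕12`.
* §1 `analyticPair_sub` — (β) IS CLOSED UNDER DIFFERENCES: the inlined `AnalyticPairWindowAt θ′ r B f` and `… B′ f′` give `… (B + B′) (f − f′)`
  (`g := g_f − g_{f′}`; `DifferentiableOn.sub`; the trace clauses share their configurations; `‖(g−g′) z − (g−g′) 0‖ ≤ B + B′`).  LEAD spec §2's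
  S2ᴴ recipe «`g := (gρ − gρ 0) − (gρ′ − gρ′ 0)`, SUP bound `2Bρ`» in kernel form.
* §2 `seedClause_mono` — the size-blind seed clause on `θ`-corners restricts to `θ∕2`-corners (`PlaqSmall` is monotone).
* §3 ★★★`seedTriple_of_seed_of_analytic` — THE TRIPLE: hypotheses = S3 v17.2's top 4-point clause text (:372, for `f U − f′ U`, letters
  `ωT·e^{−κs·tdist}`, corners `PlaqSmall θ`) + (β) for `f` and for `f′` at base window `θ∕2`, radius `rA`, profile `Bρ` (block ⑧'s two (β)
  conjuncts VERBATIM) + `0 < θ, 0 < rA ≤ 1∕12, 0 < Bρ, 0 < ωT, κ < κs∕4`; conclusion = the triple with `kT b b′ := ⟨pen 9's constant at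
  (θ∕2, rA, Bρ+Bρ, σ := ωT·e^{−κs·tdist b b′})⟩·(θ∕2)²∕4`, `wT := (800·√(32(Bρ+Bρ))·√(800·√(6(Bρ+Bρ)))∕rA²)·√√ωT·(d·(2(1+1∕(κs∕4−κ)))^d)∕4` and the
  `HClauseSq (θ∕4) (rA∕2) kT (fun U => f U − f′ U)` body INLINED (Theorems files are def-free; `HClauseSq` is the draft's `def`) — `exact` after
  `unfold HClauseSq` on the consumer side; ★`seedTriple_of_seed_of_analytic_three` — the d = 3 reading on `F.P K` (`wT` with `3·(…)³`).
So `runPairSeedH_of_seed` (ideator's name) := this theorem at `P := F.P T`, level `0`, `θ := θBal F.L γ b₀ p₀ T`, `f := fun U => Real.log (ρ T U)`,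
`f′ := fun U => Real.log (ρ′ T U)` — zero mathematics left on the Lines side.

HONEST: quantifier threading + real arithmetic over landed kernel facts; the seed clause (S3 :372, frozen №36) and (β) ([Balaban1985UV3] p.263 (c))
for the runs are HYPOTHESES here exactly as in pen 9; nothing of Bałaban's analysis is asserted or proved; O1ᵘ-H v2, S3ᴴ, `directTransport_supR`,
the five registered ∘-stubs, crux 20520 `FluctuationComparisonRegPrIntL` and `YM3TorusSU2` are NOT proved; no summit is proved by a helper.
R3 = SU(2) YM₃ on T³ — NOT d = 4, NOT infinite volume, NOT a mass gap, NOT Clay; the Yang–Mills mass gap is NOT proved.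
[cite: Balaban1985UV3, p.263; Balaban1984PropagatorsII, (2.61) p.234]
-/

set_option autoImplicit false

noncomputable section

open Function Metric Set
open Literature.MathematicalPhysics.QuantumFieldTheory.Balaban1983to89
open T4CubeChartExp (expPt)
open Summit.QuantumFields.YangMills.Theorems.OrganTangentSeedHClause (hClauseSq_of_seed_of_analytic)
open Summit.QuantumFields.YangMills.Theorems.OrganTangentSeedRowMass (seedLetter_div_four_nonneg rowMass_seedLetter_div_four_le)

namespace Summit.QuantumFields.YangMills.Theorems.OrganTangentSeedHTriple

variable {P : Params} {j : ℕ}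

/-! ## §1 (β) is closed under differences -/

/-- **(β) FOR A DIFFERENCE**: if `f` and `f′` both satisfy the analyticity predicate `AnalyticPairWindowAt θ′ r · ·` (LEAD spec §1 text,
inlined) with oscillation profiles `B`, `B′`, then so does `f − f′` with profile `B + B′` — `g := g_f − g_{f′}`. [cite: Balaban1985UV3, p.263] -/
theorem analyticPair_sub {θ' r B B' : ℝ} {f f' : GaugeField P j (Matrix.specialUnitaryGroup (Fin 2) ℂ) → ℝ}
    (hβ : ∀ U : GaugeField P j (Matrix.specialUnitaryGroup (Fin 2) ℂ), PlaqSmall θ' U →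
      ∀ (b b' : PBond P j) (w w' : Fin 3 → ℝ), ‖w‖ ≤ 1 → ‖w'‖ ≤ 1 →
        ∃ g : ℂ × ℂ → ℂ, DifferentiableOn ℂ g (ball (0 : ℂ) (r * θ') ×ˢ ball (0 : ℂ) (r * θ')) ∧
          (∀ (s t : ℝ) (V Z : GaugeField P j (Matrix.specialUnitaryGroup (Fin 2) ℂ)), |s| < r * θ' → |t| < r * θ' →
            (∀ e, e ≠ b → V e = U e) → V b = U b * expPt (s • w) → (∀ e, e ≠ b' → Z e = V e) → Z b' = V b' * expPt (t • w') →
            g ((s : ℂ), (t : ℂ)) = ((f Z : ℝ) : ℂ)) ∧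
          ∀ z ∈ ball (0 : ℂ) (r * θ') ×ˢ ball (0 : ℂ) (r * θ'), ‖g z - g 0‖ ≤ B)
    (hβ' : ∀ U : GaugeField P j (Matrix.specialUnitaryGroup (Fin 2) ℂ), PlaqSmall θ' U →
      ∀ (b b' : PBond P j) (w w' : Fin 3 → ℝ), ‖w‖ ≤ 1 → ‖w'‖ ≤ 1 →
        ∃ g : ℂ × ℂ → ℂ, DifferentiableOn ℂ g (ball (0 : ℂ) (r * θ') ×ˢ ball (0 : ℂ) (r * θ')) ∧
          (∀ (s t : ℝ) (V Z : GaugeField P j (Matrix.specialUnitaryGroup (Fin 2) ℂ)), |s| < r * θ' → |t| < r * θ' →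
            (∀ e, e ≠ b → V e = U e) → V b = U b * expPt (s • w) → (∀ e, e ≠ b' → Z e = V e) → Z b' = V b' * expPt (t • w') →
            g ((s : ℂ), (t : ℂ)) = ((f' Z : ℝ) : ℂ)) ∧
          ∀ z ∈ ball (0 : ℂ) (r * θ') ×ˢ ball (0 : ℂ) (r * θ'), ‖g z - g 0‖ ≤ B') :
    ∀ U : GaugeField P j (Matrix.specialUnitaryGroup (Fin 2) ℂ), PlaqSmall θ' U →
      ∀ (b b' : PBond P j) (w w' : Fin 3 → ℝ), ‖w‖ ≤ 1 → ‖w'‖ ≤ 1 →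
        ∃ g : ℂ × ℂ → ℂ, DifferentiableOn ℂ g (ball (0 : ℂ) (r * θ') ×ˢ ball (0 : ℂ) (r * θ')) ∧
          (∀ (s t : ℝ) (V Z : GaugeField P j (Matrix.specialUnitaryGroup (Fin 2) ℂ)), |s| < r * θ' → |t| < r * θ' →
            (∀ e, e ≠ b → V e = U e) → V b = U b * expPt (s • w) → (∀ e, e ≠ b' → Z e = V e) → Z b' = V b' * expPt (t • w') →
            g ((s : ℂ), (t : ℂ)) = (((f Z - f' Z : ℝ) : ℝ) : ℂ)) ∧
          ∀ z ∈ ball (0 : ℂ) (r * θ') ×ˢ ball (0 : ℂ) (r * θ'), ‖g z - g 0‖ ≤ B + B' := by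
  intro U hU b b' w w' hw hw'
  obtain ⟨g, hg, htr, hosc⟩ := hβ U hU b b' w w' hw hw'
  obtain ⟨g', hg', htr', hosc'⟩ := hβ' U hU b b' w w' hw hw'
  refine ⟨fun z => g z - g' z, hg.sub hg', ?_, ?_⟩
  · intro s t V Z hs ht hVU hVb hZV hZb
    show g ((s : ℂ), (t : ℂ)) - g' ((s : ℂ), (t : ℂ)) = _
    rw [htr s t V Z hs ht hVU hVb hZV hZb, htr' s t V Z hs ht hVU hVb hZV hZb]
    push_cast
    ring
  · intro z hz
    show ‖(g z - g' z) - (g 0 - g' 0)‖ ≤ B + B'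
    calc ‖(g z - g' z) - (g 0 - g' 0)‖ = ‖(g z - g 0) - (g' z - g' 0)‖ := by ring_nf
      _ ≤ ‖g z - g 0‖ + ‖g' z - g' 0‖ := norm_sub_le _ _
      _ ≤ B + B' := add_le_add (hosc z hz) (hosc' z hz)

/-! ## §2 The size-blind seed clause restricts to smaller windows -/

/-- The size-blind 4-point seed clause (S3 v17.2 :372 shape, abstract `h`) on `θ`-corners restricts to `θ₁`-corners for `θ₁ ≤ θ`
(`PlaqSmall` is monotone in the window scale). [folklore] -/
theorem seedClause_mono {θ θ₁ ωT κs : ℝ} (hθ₁ : θ₁ ≤ θ) {h : GaugeField P j (Matrix.specialUnitaryGroup (Fin 2) ℂ) → ℝ}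
    (hseed : ∀ (b b' : PBond P j) (U V W Z : GaugeField P j (Matrix.specialUnitaryGroup (Fin 2) ℂ)),
      PlaqSmall θ U → PlaqSmall θ V → PlaqSmall θ W → PlaqSmall θ Z →
      (∀ e, e ≠ b → U e = V e) → (∀ e, e ≠ b' → U e = W e) → (∀ e, e ≠ b' → V e = Z e) → (∀ e, e ≠ b → W e = Z e) →
      |(h U - h V) - (h W - h Z)| ≤ ωT * Real.exp (-(κs * (b.src.tdist b'.src : ℝ)))) :
    ∀ (b b' : PBond P j) (U V W Z : GaugeField P j (Matrix.specialUnitaryGroup (Fin 2) ℂ)),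
      PlaqSmall θ₁ U → PlaqSmall θ₁ V → PlaqSmall θ₁ W → PlaqSmall θ₁ Z →
      (∀ e, e ≠ b → U e = V e) → (∀ e, e ≠ b' → U e = W e) → (∀ e, e ≠ b' → V e = Z e) → (∀ e, e ≠ b → W e = Z e) →
      |(h U - h V) - (h W - h Z)| ≤ ωT * Real.exp (-(κs * (b.src.tdist b'.src : ℝ))) :=
  fun b b' U V W Z hU hV hW hZ =>
    hseed b b' U V W Z (fun p => lt_of_lt_of_le (hU p) hθ₁) (fun p => lt_of_lt_of_le (hV p) hθ₁)
      (fun p => lt_of_lt_of_le (hW p) hθ₁) (fun p => lt_of_lt_of_le (hZ p) hθ₁)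

/-! ## §3 ★★★ The seed triple -/

/-- ★★★ **THE SEED TRIPLE (form (c))** — S3ᴴ's ∕ O1ᵘ-H v2's seed hypothesis EXACTLY, from S3 v17.2's size-blind top 4-point clause (for the
discrepancy `f − f′`, letters `ωT·e^{−κs·tdist}`, `θ`-corners) and (β) for `f` and `f′` at base window `θ∕2` (radius `rA ≤ 1∕12`, profile `Bρ`):
`∃ kT, (∀ b b′, 0 ≤ kT b b′) ∧ (∀ b, ∑ b′, kT b b′·e^{κ·tdist} ≤ wT) ∧ ⟨HClauseSq (θ∕4) (rA∕2) kT (fun U => f U − f′ U), inlined⟩` for every weight rate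
`κ < κs∕4`, with `wT := (800·√(32(Bρ+Bρ))·√(800·√(6(Bρ+Bρ)))∕rA²)·√√ωT·(d·(2(1+1∕(κs∕4−κ)))^d)∕4` (θ-free, side-uniform).  Witness
`kT b b′ := ⟨✓p797938's constant at (θ∕2, rA, Bρ+Bρ, σ := ωT·e^{−κs·tdist b b′})⟩·(θ∕2)²∕4`; proof = `analyticPair_sub` + `seedClause_mono` +
✓`hClauseSq_of_seed_of_analytic` (cH := 1∕2) + the size conversion `∕(θ∕2) ↦ ∕(θ∕4)` + ✓`seedLetter_div_four_nonneg` ∕ ✓`rowMass_seedLetter_div_four_le`.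
[cite: Balaban1985UV3, p.263] -/
theorem seedTriple_of_seed_of_analytic [DecidableEq (PBond P j)] {θ rA Bρ ωT κs κ : ℝ} (hθ : 0 < θ) (hrA : 0 < rA) (hrA' : rA ≤ 1 / 12) (hBρ : 0 < Bρ)
    (hω : 0 < ωT) (hκ : κ < κs / 4) (f f' : GaugeField P j (Matrix.specialUnitaryGroup (Fin 2) ℂ) → ℝ)
    (hseed : ∀ (b b' : PBond P j) (U V W Z : GaugeField P j (Matrix.specialUnitaryGroup (Fin 2) ℂ)),
      PlaqSmall θ U → PlaqSmall θ V → PlaqSmall θ W → PlaqSmall θ Z →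
      (∀ e, e ≠ b → U e = V e) → (∀ e, e ≠ b' → U e = W e) → (∀ e, e ≠ b' → V e = Z e) → (∀ e, e ≠ b → W e = Z e) →
      |(f U - f' U) - (f V - f' V) - ((f W - f' W) - (f Z - f' Z))| ≤ ωT * Real.exp (-(κs * (b.src.tdist b'.src : ℝ))))
    (hβ : ∀ U : GaugeField P j (Matrix.specialUnitaryGroup (Fin 2) ℂ), PlaqSmall (θ / 2) U →
      ∀ (b b' : PBond P j) (w w' : Fin 3 → ℝ), ‖w‖ ≤ 1 → ‖w'‖ ≤ 1 →
        ∃ g : ℂ × ℂ → ℂ, DifferentiableOn ℂ g (ball (0 : ℂ) (rA * (θ / 2)) ×ˢ ball (0 : ℂ) (rA * (θ / 2))) ∧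
          (∀ (s t : ℝ) (V Z : GaugeField P j (Matrix.specialUnitaryGroup (Fin 2) ℂ)), |s| < rA * (θ / 2) → |t| < rA * (θ / 2) →
            (∀ e, e ≠ b → V e = U e) → V b = U b * expPt (s • w) → (∀ e, e ≠ b' → Z e = V e) → Z b' = V b' * expPt (t • w') →
            g ((s : ℂ), (t : ℂ)) = ((f Z : ℝ) : ℂ)) ∧
          ∀ z ∈ ball (0 : ℂ) (rA * (θ / 2)) ×ˢ ball (0 : ℂ) (rA * (θ / 2)), ‖g z - g 0‖ ≤ Bρ)
    (hβ' : ∀ U : GaugeField P j (Matrix.specialUnitaryGroup (Fin 2) ℂ), PlaqSmall (θ / 2) U →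
      ∀ (b b' : PBond P j) (w w' : Fin 3 → ℝ), ‖w‖ ≤ 1 → ‖w'‖ ≤ 1 →
        ∃ g : ℂ × ℂ → ℂ, DifferentiableOn ℂ g (ball (0 : ℂ) (rA * (θ / 2)) ×ˢ ball (0 : ℂ) (rA * (θ / 2))) ∧
          (∀ (s t : ℝ) (V Z : GaugeField P j (Matrix.specialUnitaryGroup (Fin 2) ℂ)), |s| < rA * (θ / 2) → |t| < rA * (θ / 2) →
            (∀ e, e ≠ b → V e = U e) → V b = U b * expPt (s • w) → (∀ e, e ≠ b' → Z e = V e) → Z b' = V b' * expPt (t • w') →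
            g ((s : ℂ), (t : ℂ)) = ((f' Z : ℝ) : ℂ)) ∧
          ∀ z ∈ ball (0 : ℂ) (rA * (θ / 2)) ×ˢ ball (0 : ℂ) (rA * (θ / 2)), ‖g z - g 0‖ ≤ Bρ) :
    ∃ kT : PBond P j → PBond P j → ℝ, (∀ b b', 0 ≤ kT b b') ∧
      (∀ b, ∑ b', kT b b' * Real.exp (κ * (b.src.tdist b'.src : ℝ)) ≤
        800 * Real.sqrt (32 * (Bρ + Bρ)) * Real.sqrt (800 * Real.sqrt (6 * (Bρ + Bρ))) / rA ^ 2 * Real.sqrt (Real.sqrt ωT) *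
          ((P.d : ℝ) * (2 * (1 + 1 / (κs / 4 - κ))) ^ P.d) / 4) ∧
      ∀ (b b' : PBond P j) (v v' : Fin 3 → ℝ) (U V W Z : GaugeField P j (Matrix.specialUnitaryGroup (Fin 2) ℂ)),
        ‖v‖ ≤ rA / 2 * (θ / 4) → ‖v'‖ ≤ rA / 2 * (θ / 4) →
        PlaqSmall (θ / 4) U → PlaqSmall (θ / 4) V → PlaqSmall (θ / 4) W → PlaqSmall (θ / 4) Z →
        (∀ e, e ≠ b → V e = U e) → V b = U b * expPt v → (∀ e, e ≠ b' → W e = U e) → W b' = U b' * expPt v' →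
        (∀ e, e ≠ b' → Z e = V e) → Z b' = V b' * expPt v' →
        |(f Z - f' Z) - (f V - f' V) - (f W - f' W) + (f U - f' U)| ≤ kT b b' * (‖v‖ / (θ / 4)) * (‖v'‖ / (θ / 4)) := by
  have hθ2 : 0 < θ / 2 := by positivity
  have hB2 : 0 < Bρ + Bρ := by positivity
  have hroom : (1 / 2 : ℝ) + 6 * rA ≤ 1 := by linarith
  -- (β) for the discrepancy, profile Bρ + Bρ
  have hβd := analyticPair_sub (f := f) (f' := f') hβ hβ'
  -- the seed clause on the half window
  have hseed2 := seedClause_mono (h := fun U => f U - f' U) (θ₁ := θ / 2) (by linarith) hseed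
  refine ⟨fun b b' =>
    (25 * (2 * (4 * (3 * (Bρ + Bρ)) / (rA * (θ / 2) - rA * (θ / 2) / 4))) ^ (1 / 2 : ℝ) / (rA * (θ / 2) / 8 * (1 / 2 : ℝ) ^ 2) *
        (25 * (2 * (3 * (Bρ + Bρ))) ^ (1 / 2 : ℝ) / (rA * (θ / 2) / 8 * (1 / 2 : ℝ) ^ 2) *
          (ωT * Real.exp (-(κs * (b.src.tdist b'.src : ℝ)))) ^ (1 - 1 / 2 : ℝ)) ^ (1 - 1 / 2 : ℝ)) * (θ / 2) ^ 2 / 4,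
    fun b b' => seedLetter_div_four_nonneg hθ2 hrA hB2 hω κs b b',
    fun b => rowMass_seedLetter_div_four_le hθ2 hrA hB2 hω hκ b, ?_⟩
  intro b b' v v' U V W Z hv hv' hU hV hW hZ hVU hVb hWU hWb hZV hZb
  have hv₁ : ‖v‖ ≤ rA * (θ / 2) / 4 := by linarith
  have hv₁' : ‖v'‖ ≤ rA * (θ / 2) / 4 := by linarith
  have hwin : (1 / 2 : ℝ) * (θ / 2) = θ / 4 := by ring
  have key := hClauseSq_of_seed_of_analytic (h := fun U => f U - f' U) hθ2 hrA hB2 hω hroom hseed2 hβd b b' v v' U V W Z hv₁ hv₁'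
    (by rw [hwin]; exact hU) (by rw [hwin]; exact hV) (by rw [hwin]; exact hW) (by rw [hwin]; exact hZ) hVU hVb hWU hWb hZV hZb
  -- size conversion: K·(θ∕2)²·(‖v‖∕(θ∕2))·(‖v′‖∕(θ∕2)) = K·(θ∕2)²∕4·(‖v‖∕(θ∕4))·(‖v′‖∕(θ∕4))
  have hconv : ∀ K : ℝ, K * (θ / 2) ^ 2 * (‖v‖ / (θ / 2)) * (‖v'‖ / (θ / 2)) =
      K * (θ / 2) ^ 2 / 4 * (‖v‖ / (θ / 4)) * (‖v'‖ / (θ / 4)) := fun K => by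
    field_simp
    ring
  rw [← hconv]
  exact key

/-- ★ **d = 3 READING ON THE FAMILY'S TORI** (`P := F.P K`; the `wT` the junction books: `3·(2(1+1∕(κs∕4−κ)))³`). [cite: Balaban1985UV3, p.263] -/
theorem seedTriple_of_seed_of_analytic_three (F : T3ContinuumYM3Torus.T3Family) (K j : ℕ) [DecidableEq (PBond (F.P K) j)]
    {θ rA Bρ ωT κs κ : ℝ} (hθ : 0 < θ)
    (hrA : 0 < rA) (hrA' : rA ≤ 1 / 12) (hBρ : 0 < Bρ) (hω : 0 < ωT) (hκ : κ < κs / 4)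
    (f f' : GaugeField (F.P K) j (Matrix.specialUnitaryGroup (Fin 2) ℂ) → ℝ)
    (hseed : ∀ (b b' : PBond (F.P K) j) (U V W Z : GaugeField (F.P K) j (Matrix.specialUnitaryGroup (Fin 2) ℂ)),
      PlaqSmall θ U → PlaqSmall θ V → PlaqSmall θ W → PlaqSmall θ Z →
      (∀ e, e ≠ b → U e = V e) → (∀ e, e ≠ b' → U e = W e) → (∀ e, e ≠ b' → V e = Z e) → (∀ e, e ≠ b → W e = Z e) →
      |(f U - f' U) - (f V - f' V) - ((f W - f' W) - (f Z - f' Z))| ≤ ωT * Real.exp (-(κs * (b.src.tdist b'.src : ℝ))))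
    (hβ : ∀ U : GaugeField (F.P K) j (Matrix.specialUnitaryGroup (Fin 2) ℂ), PlaqSmall (θ / 2) U →
      ∀ (b b' : PBond (F.P K) j) (w w' : Fin 3 → ℝ), ‖w‖ ≤ 1 → ‖w'‖ ≤ 1 →
        ∃ g : ℂ × ℂ → ℂ, DifferentiableOn ℂ g (ball (0 : ℂ) (rA * (θ / 2)) ×ˢ ball (0 : ℂ) (rA * (θ / 2))) ∧
          (∀ (s t : ℝ) (V Z : GaugeField (F.P K) j (Matrix.specialUnitaryGroup (Fin 2) ℂ)), |s| < rA * (θ / 2) → |t| < rA * (θ / 2) →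
            (∀ e, e ≠ b → V e = U e) → V b = U b * expPt (s • w) → (∀ e, e ≠ b' → Z e = V e) → Z b' = V b' * expPt (t • w') →
            g ((s : ℂ), (t : ℂ)) = ((f Z : ℝ) : ℂ)) ∧
          ∀ z ∈ ball (0 : ℂ) (rA * (θ / 2)) ×ˢ ball (0 : ℂ) (rA * (θ / 2)), ‖g z - g 0‖ ≤ Bρ)
    (hβ' : ∀ U : GaugeField (F.P K) j (Matrix.specialUnitaryGroup (Fin 2) ℂ), PlaqSmall (θ / 2) U →
      ∀ (b b' : PBond (F.P K) j) (w w' : Fin 3 → ℝ), ‖w‖ ≤ 1 → ‖w'‖ ≤ 1 →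
        ∃ g : ℂ × ℂ → ℂ, DifferentiableOn ℂ g (ball (0 : ℂ) (rA * (θ / 2)) ×ˢ ball (0 : ℂ) (rA * (θ / 2))) ∧
          (∀ (s t : ℝ) (V Z : GaugeField (F.P K) j (Matrix.specialUnitaryGroup (Fin 2) ℂ)), |s| < rA * (θ / 2) → |t| < rA * (θ / 2) →
            (∀ e, e ≠ b → V e = U e) → V b = U b * expPt (s • w) → (∀ e, e ≠ b' → Z e = V e) → Z b' = V b' * expPt (t • w') →
            g ((s : ℂ), (t : ℂ)) = ((f' Z : ℝ) : ℂ)) ∧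
          ∀ z ∈ ball (0 : ℂ) (rA * (θ / 2)) ×ˢ ball (0 : ℂ) (rA * (θ / 2)), ‖g z - g 0‖ ≤ Bρ) :
    ∃ kT : PBond (F.P K) j → PBond (F.P K) j → ℝ, (∀ b b', 0 ≤ kT b b') ∧
      (∀ b, ∑ b', kT b b' * Real.exp (κ * (b.src.tdist b'.src : ℝ)) ≤
        800 * Real.sqrt (32 * (Bρ + Bρ)) * Real.sqrt (800 * Real.sqrt (6 * (Bρ + Bρ))) / rA ^ 2 * Real.sqrt (Real.sqrt ωT) *
          (3 * (2 * (1 + 1 / (κs / 4 - κ))) ^ 3) / 4) ∧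
      ∀ (b b' : PBond (F.P K) j) (v v' : Fin 3 → ℝ) (U V W Z : GaugeField (F.P K) j (Matrix.specialUnitaryGroup (Fin 2) ℂ)),
        ‖v‖ ≤ rA / 2 * (θ / 4) → ‖v'‖ ≤ rA / 2 * (θ / 4) →
        PlaqSmall (θ / 4) U → PlaqSmall (θ / 4) V → PlaqSmall (θ / 4) W → PlaqSmall (θ / 4) Z →
        (∀ e, e ≠ b → V e = U e) → V b = U b * expPt v → (∀ e, e ≠ b' → W e = U e) → W b' = U b' * expPt v' →
        (∀ e, e ≠ b' → Z e = V e) → Z b' = V b' * expPt v' →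
        |(f Z - f' Z) - (f V - f' V) - (f W - f' W) + (f U - f' U)| ≤ kT b b' * (‖v‖ / (θ / 4)) * (‖v'‖ / (θ / 4)) := by
  obtain ⟨kT, h0, hrow, hH⟩ := seedTriple_of_seed_of_analytic hθ hrA hrA' hBρ hω hκ f f' hseed hβ hβ'
  refine ⟨kT, h0, fun b => ?_, hH⟩
  have h := hrow b
  have hd : (F.P K).d = 3 := rfl
  rw [hd] at h
  exact_mod_cast h

end Summit.QuantumFields.YangMills.Theorems.OrganTangentSeedHTriple

end
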